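import Literature.Computability.AlgebraicComplexity.HI16DetSkewCircuitProofs
import Literature.Computability.AlgebraicComplexity.ArithCircuitProofs
import Literature.Computability.AlgebraicComplexity.ValiantClasses
import HarnessLib

/-!
# The noncrossing-matching interval DP is a `VP` circuit (support for `FifoMatching.NCInVP`)

Helper toward route item `stmt-ValiantsHypothesis-11619` (`Theses.FifoMatching.NCInVP`): the
interval dynamic programme
`NC[i,j) = Σ_{i<a<j} x_{i,a} · NC[i+1,a) · NC[a+1,j)`, `NC[i,i) = 1`
(first-arc decomposition of noncrossing perfect matchings), compiled to a fan-in-two arithmetic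
circuit with `O(n³)` gates by the register-program framework `ArithCircuit.RegProg`
(`HI16DetSkewCircuitProofs.lean`): `complexity (ncRec n 0 (2n)) ≤ 4 (2n+1)³`, the degree is
`≤ 2n`, hence the DP family is a `VP` family (`isVPFamily_ncRec`). The identification of
`ncRec n 0 (2n)` with the item's sum over noncrossing fixed-point-free involutions is the sibling
step. [folklore; Bürgisser 2000 Def. 2.1–2.4 for the circuit model]
-/

noncomputable section

-- layout Summits/ValiantsHypothesis/ValiantsHypothesis forces the duplicated namespace component
set_option linter.dupNamespace false

namespace Summit.ValiantsHypothesis.ValiantsHypothesis.Theorems.FifoMatching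

open Literature.Computability.AlgebraicComplexity MvPolynomial
open Literature.Computability.AlgebraicComplexity.ArithCircuit

universe u

variable (k : Type u) [CommSemiring k]

/-! ### The DP polynomials -/

/-- The variable `x_{i,a}` of the `2n × 2n` matrix (`0` out of range). [folklore] -/
def xv (n i a : ℕ) : MvPolynomial (Fin (2 * n) × Fin (2 * n)) k :=
  if h : i < 2 * n ∧ a < 2 * n then X (⟨i, h.1⟩, ⟨a, h.2⟩) else 0

/-- **The interval DP** `NC[i,j) = Σ_{i<a<j} x_{i,a} NC[i+1,a) NC[a+1,j)`, `NC[i,j) = 1` for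
`j ≤ i` (noncrossing perfect matchings of the interval `[i,j)`, by the partner `a` of `i`).
[folklore] -/
def ncRec (n : ℕ) : ℕ → ℕ → MvPolynomial (Fin (2 * n) × Fin (2 * n)) k
  | i, j =>
    if i < j then
      ∑ a ∈ (Finset.Ioo i j).attach,
        xv k n i a.1 * ncRec n (i + 1) a.1 * ncRec n (a.1 + 1) j
    else 1
  termination_by i j => j - i
  decreasing_by
    all_goals
      have ha := Finset.mem_Ioo.mp a.2
      omega

/-- One summand of the DP: `x_{i,a} NC[i+1,a) NC[a+1,j)`. [folklore] -/
def ncTerm (n i a j : ℕ) : MvPolynomial (Fin (2 * n) × Fin (2 * n)) k :=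
  xv k n i a * ncRec k n (i + 1) a * ncRec k n (a + 1) j

variable {k}

/-- The DP equation on a nonempty interval. [folklore] -/
theorem ncRec_of_lt (n : ℕ) {i j : ℕ} (h : i < j) :
    ncRec k n i j = ∑ a ∈ Finset.Ioo i j, ncTerm k n i a j := by
  rw [ncRec, if_pos h]
  exact Finset.sum_attach (Finset.Ioo i j) (fun a => ncTerm k n i a j)

/-- The DP on an empty interval. [folklore] -/
theorem ncRec_of_le (n : ℕ) {i j : ℕ} (h : j ≤ i) : ncRec k n i j = 1 := by
  rw [ncRec, if_neg (Nat.not_lt.mpr h)]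

/-- Registers: `nc i j` = `NC[i,j)`; `pr1 i a j` = `x_{i,a} NC[i+1,a)`; `pr2 i a j` = the full summand
`x_{i,a} NC[i+1,a) NC[a+1,j)`; `acc i j a` = the partial sum over `i < a' < a`. [folklore] -/
inductive Reg : Type
  /-- the interval value `NC[i,j)` -/
  | nc (i j : ℕ) : Reg
  /-- the partial product `x_{i,a} NC[i+1,a)` -/
  | pr1 (i a j : ℕ) : Reg
  /-- the full summand `x_{i,a} NC[i+1,a) NC[a+1,j)` -/
  | pr2 (i a j : ℕ) : Reg
  /-- the partial sum of the summands over `i < a' < a` -/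
  | acc (i j a : ℕ) : Reg
  deriving DecidableEq

variable (k)
variable (n : ℕ)

/-- The input operand `x_{i,a}` (constant `0` out of range). [folklore] -/
def xop (i a : ℕ) : ROperand k (Fin (2 * n) × Fin (2 * n)) Reg :=
  if h : i < 2 * n ∧ a < 2 * n then .var (⟨i, h.1⟩, ⟨a, h.2⟩) else .const 0

/-- The defining gates (all of fan-in at most two). [folklore] -/
def gateOf : Reg → RGate k (Fin (2 * n) × Fin (2 * n)) Reg
  | .nc i j => if i < j then .sum [(1, .reg (.acc i j j))] else .sum [(1, .const 1)]
  | .pr1 i a _ => .prod [xop k n i a, .reg (.nc (i + 1) a)]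
  | .pr2 i a j => .prod [.reg (.pr1 i a j), .reg (.nc (a + 1) j)]
  | .acc i j a => if a ≤ i + 1 then .sum []
      else .sum [(1, .reg (.acc i j (a - 1))), (1, .reg (.pr2 i (a - 1) j))]

/-- The rank: by interval length `j - i` (scaled by `2n + 4`), then products, partial sums by
length, and the interval value last. [folklore] -/
def rank : Reg → ℕ
  | .nc i j => (j - i) * (2 * n + 4) + (j - i) + 3
  | .pr1 i _ j => (j - i) * (2 * n + 4)
  | .pr2 i _ j => (j - i) * (2 * n + 4) + 1
  | .acc i j a => (j - i) * (2 * n + 4) + 2 + (a - i)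

/-- The intended values of the registers. [folklore] -/
def val : Reg → MvPolynomial (Fin (2 * n) × Fin (2 * n)) k
  | .nc i j => ncRec k n i j
  | .pr1 i a _ => xv k n i a * ncRec k n (i + 1) a
  | .pr2 i a j => ncTerm k n i a j
  | .acc i j a => ∑ a' ∈ Finset.Ico (i + 1) a, ncTerm k n i a' j

/-- The interval registers `nc i j`, `i ≤ j ≤ 2n`. [folklore] -/
def ncRegs : List Reg :=
  (List.range (2 * n + 1)).flatMap fun j => (List.range (j + 1)).map fun i => .nc i j

/-- The product registers, `i < a < j ≤ 2n`. [folklore] -/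
def prRegs : List Reg :=
  (List.range (2 * n + 1)).flatMap fun j => (List.range j).flatMap fun a =>
    (List.range a).flatMap fun i => [.pr1 i a j, .pr2 i a j]

/-- The partial-sum registers `acc i j a`, `i < j ≤ 2n`, `i + 1 ≤ a ≤ j`. [folklore] -/
def accRegs : List Reg :=
  (List.range (2 * n + 1)).flatMap fun j => (List.range j).flatMap fun i =>
    (List.range (j - i)).map fun t => .acc i j (i + 1 + t)

/-- All registers. [folklore] -/
def regs : List Reg := ncRegs n ++ prRegs n ++ accRegs n

/-- **The register program for `NC[0,2n)`.** [folklore] -/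
def prog : RegProg k (Fin (2 * n) × Fin (2 * n)) Reg where
  regs := regs n
  rank := rank n
  gateOf := gateOf k n
  output := .reg (.nc 0 (2 * n))

variable {k n}

/-- The interval registers present: `i ≤ j ≤ 2n`. [folklore] -/
theorem mem_regs_nc {i j : ℕ} : Reg.nc i j ∈ regs n ↔ i ≤ j ∧ j ≤ 2 * n := by
  simp only [regs, ncRegs, prRegs, accRegs, List.mem_append, List.mem_flatMap, List.mem_range,
    List.mem_map, List.mem_cons, List.not_mem_nil, Reg.nc.injEq, reduceCtorEq, or_false,
    and_false, exists_false, or_self]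
  constructor
  · rintro ⟨j', hj', i', hi', rfl, rfl⟩; omega
  · rintro ⟨h1, h2⟩; exact ⟨j, by omega, i, by omega, rfl, rfl⟩

/-- The first-product registers present: `i < a < j ≤ 2n`. [folklore] -/
theorem mem_regs_pr1 {i a j : ℕ} : Reg.pr1 i a j ∈ regs n ↔ i < a ∧ a < j ∧ j ≤ 2 * n := by
  simp only [regs, ncRegs, prRegs, accRegs, List.mem_append, List.mem_flatMap, List.mem_range,
    List.mem_map, List.mem_cons, List.not_mem_nil, Reg.pr1.injEq, reduceCtorEq, or_false,
    and_false, exists_false, or_self, false_or]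
  constructor
  · rintro ⟨j', hj', a', ha', i', hi', rfl, rfl, rfl⟩; omega
  · rintro ⟨h1, h2, h3⟩; exact ⟨j, by omega, a, h2, i, h1, rfl, rfl, rfl⟩

/-- The summand registers present: `i < a < j ≤ 2n`. [folklore] -/
theorem mem_regs_pr2 {i a j : ℕ} : Reg.pr2 i a j ∈ regs n ↔ i < a ∧ a < j ∧ j ≤ 2 * n := by
  simp only [regs, ncRegs, prRegs, accRegs, List.mem_append, List.mem_flatMap, List.mem_range,
    List.mem_map, List.mem_cons, List.not_mem_nil, Reg.pr2.injEq, reduceCtorEq, or_false,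
    and_false, exists_false, false_or]
  constructor
  · rintro ⟨j', hj', a', ha', i', hi', rfl, rfl, rfl⟩; omega
  · rintro ⟨h1, h2, h3⟩; exact ⟨j, by omega, a, h2, i, h1, rfl, rfl, rfl⟩

/-- The partial-sum registers present: `i < j ≤ 2n`, `i + 1 ≤ a ≤ j`. [folklore] -/
theorem mem_regs_acc {i j a : ℕ} :
    Reg.acc i j a ∈ regs n ↔ i < j ∧ j ≤ 2 * n ∧ i + 1 ≤ a ∧ a ≤ j := by
  simp only [regs, ncRegs, prRegs, accRegs, List.mem_append, List.mem_flatMap, List.mem_range,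
    List.mem_map, List.mem_cons, List.not_mem_nil, Reg.acc.injEq, reduceCtorEq,
    and_false, exists_false, or_self, false_or]
  constructor
  · rintro ⟨j', hj', i', hi', t, ht, rfl, rfl, rfl⟩; omega
  · rintro ⟨h1, h2, h3, h4⟩; exact ⟨j, by omega, i, h1, a - (i + 1), by omega, rfl, rfl, by omega⟩

/-- The input operand reads the variable `x_{i,a}` (or `0`). [folklore] -/
theorem eval_xop (V : Reg → MvPolynomial (Fin (2 * n) × Fin (2 * n)) k) (i a : ℕ) :
    (xop k n i a).eval V = xv k n i a := by
  unfold xop xv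
  split_ifs <;> simp [ROperand.eval]

/-- **The local equations hold** for every register. [folklore] -/
theorem realizes : (prog k n).Realizes (val k n) := by
  intro r
  change (gateOf k n r).eval (val k n) = val k n r
  rcases r with ⟨i, j⟩ | ⟨i, a, j⟩ | ⟨i, a, j⟩ | ⟨i, j, a⟩
  · -- interval values
    by_cases h : i < j
    · rw [gateOf, if_pos h, val, ncRec_of_lt n h,
        show Finset.Ioo i j = Finset.Ico (i + 1) j from by ext x; simp]
      simp [RGate.eval, val]
    · rw [gateOf, if_neg h, val, ncRec_of_le n (Nat.not_lt.mp h)]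
      simp [RGate.eval]
  · -- first partial product
    simp only [gateOf, RGate.eval, List.map_cons, List.map_nil, List.prod_cons, List.prod_nil,
      mul_one, eval_xop, ROperand.eval_reg, val]
  · -- full summand
    simp only [gateOf, RGate.eval, List.map_cons, List.map_nil, List.prod_cons, List.prod_nil,
      mul_one, ROperand.eval_reg, val, ncTerm]
  · -- partial sums
    by_cases h : a ≤ i + 1
    · rw [gateOf, if_pos h, val, Finset.Ico_eq_empty (by omega)]
      simp [RGate.eval]
    · rw [gateOf, if_neg h, val]
      obtain ⟨b, rfl⟩ : ∃ b, a = b + 1 := ⟨a - 1, by omega⟩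
      rw [Nat.add_sub_cancel, Finset.sum_Ico_succ_top (show i + 1 ≤ b by omega)]
      simp [RGate.eval, val]

/-- The input operand reads no register. [folklore] -/
theorem reads_xop (i a : ℕ) : (xop k n i a).reads = [] := by
  unfold xop
  split_ifs <;> rfl

/-- A rank comparison: a sub-interval at least two shorter ranks below the products of the
interval. [folklore] -/
private theorem rank_aux {L L' C : ℕ} (h : L' + 2 ≤ L) (hC : L' + 4 ≤ 2 * C) :
    L' * C + L' + 3 < L * C := by
  have h1 : (L' + 2) * C ≤ L * C := Nat.mul_le_mul_right C h
  rw [Nat.add_mul] at h1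
  omega

/-- **The program is well ranked.** [folklore] -/
theorem wellRanked : (prog k n).WellRanked := by
  intro r hr r' hr'
  change r ∈ regs n at hr
  change r' ∈ (gateOf k n r).reads at hr'
  change r' ∈ regs n ∧ rank n r' < rank n r
  rcases r with ⟨i, j⟩ | ⟨i, a, j⟩ | ⟨i, a, j⟩ | ⟨i, j, a⟩
  · rw [mem_regs_nc] at hr
    by_cases h : i < j
    · rw [gateOf, if_pos h] at hr'
      simp only [RGate.reads, List.flatMap_cons, List.flatMap_nil, ROperand.reads_reg,
        List.append_nil, List.mem_singleton] at hr'
      subst hr'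
      exact ⟨mem_regs_acc.2 ⟨h, hr.2, by omega, le_rfl⟩, by simp only [rank]; omega⟩
    · rw [gateOf, if_neg h] at hr'
      simp [RGate.reads] at hr'
  · rw [mem_regs_pr1] at hr
    simp only [gateOf, RGate.reads, List.flatMap_cons, List.flatMap_nil, List.append_nil,
      reads_xop, ROperand.reads_reg, List.nil_append, List.mem_singleton] at hr'
    subst hr'
    refine ⟨mem_regs_nc.2 ⟨by omega, by omega⟩, ?_⟩
    simp only [rank]
    exact rank_aux (by omega) (by omega)
  · rw [mem_regs_pr2] at hr
    simp only [gateOf, RGate.reads, List.flatMap_cons, List.flatMap_nil, List.append_nil,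
      ROperand.reads_reg, List.singleton_append, List.mem_cons, List.not_mem_nil, or_false] at hr'
    rcases hr' with rfl | rfl
    · exact ⟨mem_regs_pr1.2 hr, by simp only [rank]; omega⟩
    · refine ⟨mem_regs_nc.2 ⟨by omega, hr.2.2⟩, ?_⟩
      simp only [rank]
      exact (rank_aux (L := j - i) (L' := j - (a + 1)) (C := 2 * n + 4) (by omega) (by omega)).trans
        (Nat.lt_succ_self _)
  · rw [mem_regs_acc] at hr
    by_cases h : a ≤ i + 1
    · rw [gateOf, if_pos h] at hr'
      simp [RGate.reads] at hr'
    · rw [gateOf, if_neg h] at hr'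
      simp only [RGate.reads, List.flatMap_cons, List.flatMap_nil, ROperand.reads_reg,
        List.append_nil, List.singleton_append, List.mem_cons, List.not_mem_nil, or_false] at hr'
      rcases hr' with rfl | rfl
      · exact ⟨mem_regs_acc.2 ⟨hr.1, hr.2.1, by omega, by omega⟩, by simp only [rank]; omega⟩
      · exact ⟨mem_regs_pr2.2 ⟨by omega, by omega, hr.2.1⟩, by simp only [rank]; omega⟩

/-- Every defining gate has fan-in at most two. [folklore] -/
theorem fanIn_gateOf_le (r : Reg) : (gateOf k n r).fanIn ≤ 2 := by
  rcases r with ⟨i, j⟩ | ⟨i, a, j⟩ | ⟨i, a, j⟩ | ⟨i, j, a⟩ <;> simp only [gateOf] <;>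
    (try split_ifs) <;> simp [RGate.fanIn]

/-- The number of registers is at most `4 (2n+1)³`. [folklore] -/
theorem length_regs_le : (regs n).length ≤ 4 * (2 * n + 1) ^ 3 := by
  have h1 : (ncRegs n).length ≤ (2 * n + 1) * (2 * n + 1) := by
    unfold ncRegs
    rw [List.length_flatMap]
    refine (List.sum_le_card_nsmul _ (2 * n + 1) ?_).trans ?_
    · intro x hx
      simp only [List.mem_map, List.mem_range] at hx
      obtain ⟨j, hj, rfl⟩ := hx
      simp only [List.length_map, List.length_range]
      omega
    · simp
  have h2 : (prRegs n).length ≤ (2 * n + 1) * ((2 * n + 1) * ((2 * n + 1) * 2)) := by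
    unfold prRegs
    rw [List.length_flatMap]
    refine (List.sum_le_card_nsmul _ ((2 * n + 1) * ((2 * n + 1) * 2)) ?_).trans (by simp)
    intro x hx
    simp only [List.mem_map, List.mem_range] at hx
    obtain ⟨j, hj, rfl⟩ := hx
    rw [List.length_flatMap]
    refine (List.sum_le_card_nsmul _ ((2 * n + 1) * 2) ?_).trans ?_
    · intro y hy
      simp only [List.mem_map, List.mem_range] at hy
      obtain ⟨a, ha, rfl⟩ := hy
      rw [List.length_flatMap]
      refine (List.sum_le_card_nsmul _ 2 ?_).trans ?_
      · intro z hz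
        simp only [List.mem_map, List.mem_range] at hz
        obtain ⟨i, hi, rfl⟩ := hz
        simp
      · simp only [List.length_map, List.length_range, smul_eq_mul]
        have : a ≤ 2 * n + 1 := by omega
        exact Nat.mul_le_mul_right 2 this
    · simp only [List.length_map, List.length_range, smul_eq_mul]
      exact Nat.mul_le_mul_right _ (by omega)
  have h3 : (accRegs n).length ≤ (2 * n + 1) * ((2 * n + 1) * (2 * n + 1)) := by
    unfold accRegs
    rw [List.length_flatMap]
    refine (List.sum_le_card_nsmul _ ((2 * n + 1) * (2 * n + 1)) ?_).trans (by simp)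
    intro x hx
    simp only [List.mem_map, List.mem_range] at hx
    obtain ⟨j, hj, rfl⟩ := hx
    rw [List.length_flatMap]
    refine (List.sum_le_card_nsmul _ (2 * n + 1) ?_).trans ?_
    · intro y hy
      simp only [List.mem_map, List.mem_range] at hy
      obtain ⟨i, hi, rfl⟩ := hy
      simp only [List.length_map, List.length_range]
      omega
    · simp only [List.length_map, List.length_range, smul_eq_mul]
      exact Nat.mul_le_mul_right _ (by omega)
  rw [regs, List.length_append, List.length_append]
  nlinarith [h1, h2, h3]

/-- **The DP value `NC[0,2n)` has a fan-in-two circuit of size `≤ 4 (2n+1)³`.** [folklore] -/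
theorem complexity_ncRec_le (n : ℕ) :
    complexity (ncRec k n 0 (2 * n)) ≤ 4 * (2 * n + 1) ^ 3 := by
  classical
  have hcomp : (prog k n).compile.Computes (ncRec k n 0 (2 * n)) := by
    rw [ArithCircuit.Computes, RegProg.eval_compile (prog k n) wellRanked realizes]
    · rfl
    · intro r' hr'
      simp only [prog, ROperand.reads_reg, List.mem_singleton] at hr'
      subst hr'
      exact mem_regs_nc.2 ⟨Nat.zero_le _, le_rfl⟩
  refine (ArithCircuit.complexity_le_size
    (RegProg.isFanInTwo_compile (prog k n) fun r _ => fanIn_gateOf_le r) hcomp).trans ?_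
  rw [RegProg.size_compile]
  exact length_regs_le

/-- The DP values have degree at most the interval length. [folklore] -/
theorem totalDegree_ncRec_le (n : ℕ) : ∀ L i j : ℕ, j - i ≤ L → (ncRec k n i j).totalDegree ≤ j - i := by
  intro L
  induction L with
  | zero =>
    intro i j h
    rw [ncRec_of_le n (by omega)]
    simp
  | succ L ih =>
    intro i j h
    by_cases hij : i < j
    · rw [ncRec_of_lt n hij]
      refine (totalDegree_finsetSum _ _).trans (Finset.sup_le fun a ha => ?_)
      rw [Finset.mem_Ioo] at ha
      unfold ncTerm
      refine (totalDegree_mul _ _).trans ?_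
      refine (Nat.add_le_add (totalDegree_mul _ _) (ih (a + 1) j (by omega))).trans ?_
      have hx : (xv k n i a).totalDegree ≤ 1 := by
        unfold xv; split_ifs
        · exact (totalDegree_monomial_le _ _).trans (by simp)
        · simp
      have := ih (i + 1) a (by omega)
      omega
    · rw [ncRec_of_le n (Nat.not_lt.mp hij)]
      simp

/-- **The DP family `n ↦ NC[0,2n)` is a `VP` family** (Bürgisser 2000, Def. 2.4):
`4n²` variables, degree `≤ 2n`, complexity `≤ 4(2n+1)³`. [folklore] -/
theorem isVPFamily_ncRec : IsVPFamily (fun n => ncRec k n 0 (2 * n)) := by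
  refine ⟨⟨?_, ?_⟩, ?_⟩
  · refine (isPBounded_iff_exists_polynomial_holds _).2 ⟨4 * Polynomial.X ^ 2, fun n => ?_⟩
    simp [Fintype.card_prod, Fintype.card_fin]
    nlinarith
  · refine (isPBounded_iff_exists_polynomial_holds _).2 ⟨2 * Polynomial.X, fun n => ?_⟩
    have := totalDegree_ncRec_le (k := k) n (2 * n) 0 (2 * n) le_rfl
    simpa using this
  · refine (isPBounded_iff_exists_polynomial_holds _).2 ⟨4 * (2 * Polynomial.X + 1) ^ 3, fun n => ?_⟩
    have := complexity_ncRec_le (k := k) n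
    simp only [Polynomial.eval_mul, Polynomial.eval_pow, Polynomial.eval_add, Polynomial.eval_X,
      Polynomial.eval_ofNat, Polynomial.eval_one]
    exact this

end Summit.ValiantsHypothesis.ValiantsHypothesis.Theorems.FifoMatching

end
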